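import Mathlib
import Summits.QuantumFields.QCD.Theorems.QuarksAsStableActionCriticalLineDiamagnetismStubDetPerturbIR
import Summits.QuantumFields.QCD.Theorems.QuarksAsStableActionCriticalLineDiamagnetismStubLogDetSecondOrder

/-!
# Uniform per-block determinant estimate
(helper for crux stmt-QuantumFields-9734, line `Sketch`, stub `stub_blockEstimate`)

Abstract finite-dimensional linear algebra over `ℂ` (no lattice objects).  For a COERCIVE square
matrix `B` (`h Σᵢ ‖vᵢ‖² ≤ Σᵢ ‖(B v)ᵢ‖²` for all `v`, `h > 0`) and a perturbation `Δ` with the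
Frobenius bound `Σᵢⱼ ‖Δᵢⱼ‖² ≤ Φ` and the operator bound `Σᵢ ‖(Δ v)ᵢ‖² ≤ α Σᵢ ‖vᵢ‖²`, writing
`R = B⁻¹ Δ`, `q = Re tr R − ½ Re tr R²`, `n = |ι|`:

  `‖det (B + Δ)‖ ≤ ‖det B‖ · exp (q + (8 √(nΦ) α + 2 Φ √α + 2 n α √α) · √h / h²)`.

Proof: a case split in `h` versus `4α`.
* `h ≤ 4α` (infrared blocks, `ir_case`): the landed IR lemma `stub_detPerturbIR` bounds the
  exponent by `A = √(n/h) ‖Δ‖_F + ‖Δ‖_F²/(2h)`; the same quantity bounds `−q`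
  (`−Re tr R ≤ √(n/h) ‖Δ‖_F` is `StubDetPerturbIRAux.re_trace_inv_mul_le` applied to `−Δ`, and
  `Re tr R² ≤ ‖R‖_F² ≤ ‖Δ‖_F²/h`), so the exponent is at most `q + 2A`, and
  `2A ≤ 2 √(nΦ)/√h + Φ/h` is converted with `1/√h = h · (√h/h²) ≤ 4α · (√h/h²)` and
  `1/h = √h · (√h/h²) ≤ 2√α · (√h/h²)` (`ir_arith`).
* `4α ≤ h` (bulk blocks, `bulk_case`): `B + Δ = B (1 + R)` and
  `Σᵢ ‖(R v)ᵢ‖² ≤ (α/h) Σᵢ ‖vᵢ‖²` with `ρ = √(α/h) ≤ 1/2`, so the landed bulk lemma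
  `stub_logDetSecondOrder` gives `‖det (1 + R)‖ ≤ exp (q + 2 n ρ³)`, and `ρ³ = α √α · (√h/h²)`.
In either case the remaining terms of the prefactor are nonnegative.

Pure theorem file (no definitions); Mathlib + the two landed stub files
`…CriticalLineDiamagnetismStubDetPerturbIR` and `…CriticalLineDiamagnetismStubLogDetSecondOrder`.
-/

noncomputable section

open scoped BigOperators Classical Matrix ComplexConjugate
open Finset
open Literature.MathematicalPhysics.QuantumLattice Literature.MathematicalPhysics.QuantumFieldTheory
  Literature.Probability.LatticeModels

namespace Summit.QuantumFields.QCD.Cruxes.CriticalLineDiamagnetism.ChessboardCellGain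

namespace BlockEstimate

open Matrix Complex StubDetPerturbIRAux

variable {ι : Type} [Fintype ι] [DecidableEq ι]

/-- Frobenius bound on `B⁻¹ Δ` for coercive `B`: `Σᵢⱼ ‖(B⁻¹ Δ)ᵢⱼ‖² ≤ ‖Δ‖_F² / c`
(column by column through `sum_norm_sq_inv_mulVec_le`). -/
theorem frob_inv_mul_le (B Δ : Matrix ι ι ℂ) {c : ℝ} (hc : 0 < c)
    (hB : ∀ v : ι → ℂ, c * ∑ i, ‖v i‖ ^ 2 ≤ ∑ i, ‖(B.mulVec v) i‖ ^ 2) :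
    ∑ i, ∑ j, ‖(B⁻¹ * Δ) i j‖ ^ 2 ≤ (∑ i, ∑ j, ‖Δ i j‖ ^ 2) / c := by
  have hcol : ∀ j, ∑ i, ‖(B⁻¹ * Δ) i j‖ ^ 2 ≤ (∑ i, ‖Δ i j‖ ^ 2) / c := fun j => by
    have h := sum_norm_sq_inv_mulVec_le B hc hB (fun i => Δ i j)
    simpa only [mulVec, dotProduct, mul_apply] using h
  calc ∑ i, ∑ j, ‖(B⁻¹ * Δ) i j‖ ^ 2 = ∑ j, ∑ i, ‖(B⁻¹ * Δ) i j‖ ^ 2 := Finset.sum_comm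
    _ ≤ ∑ j, (∑ i, ‖Δ i j‖ ^ 2) / c := Finset.sum_le_sum fun j _ => hcol j
    _ = (∑ i, ∑ j, ‖Δ i j‖ ^ 2) / c := by rw [← Finset.sum_div, Finset.sum_comm]

omit [DecidableEq ι] in
/-- `Re tr (M M) ≤ ‖M‖_F²`, termwise from `Re (Mᵢⱼ Mⱼᵢ) ≤ (‖Mᵢⱼ‖² + ‖Mⱼᵢ‖²) / 2`. -/
theorem re_trace_mul_self_le (M : Matrix ι ι ℂ) :
    (M * M).trace.re ≤ ∑ i, ∑ j, ‖M i j‖ ^ 2 := by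
  have h2 : ∀ i j, (M i j * M j i).re ≤ ‖M i j‖ ^ 2 / 2 + ‖M j i‖ ^ 2 / 2 := fun i j => by
    refine (Complex.re_le_norm _).trans ?_
    rw [norm_mul]
    nlinarith [sq_nonneg (‖M i j‖ - ‖M j i‖)]
  have hsymm : ∑ i, ∑ j, ‖M j i‖ ^ 2 / 2 = ∑ i, ∑ j, ‖M i j‖ ^ 2 / 2 := Finset.sum_comm
  calc (M * M).trace.re = ∑ i, ∑ j, (M i j * M j i).re := by
        simp only [Matrix.trace, Matrix.diag, Matrix.mul_apply, Complex.re_sum]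
    _ ≤ ∑ i, ∑ j, (‖M i j‖ ^ 2 / 2 + ‖M j i‖ ^ 2 / 2) :=
        Finset.sum_le_sum fun i _ => Finset.sum_le_sum fun j _ => h2 i j
    _ = ∑ i, ∑ j, ‖M i j‖ ^ 2 / 2 + ∑ i, ∑ j, ‖M j i‖ ^ 2 / 2 := by
        simp only [Finset.sum_add_distrib]
    _ = ∑ i, ∑ j, ‖M i j‖ ^ 2 := by
        rw [hsymm, ← Finset.sum_add_distrib]
        refine Finset.sum_congr rfl fun i _ => ?_
        rw [← Finset.sum_add_distrib]
        refine Finset.sum_congr rfl fun j _ => ?_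
        ring

/-- Power bookkeeping: `1/√h = h · (√h/h²)` for `h > 0`. -/
theorem one_div_sqrt_eq {h : ℝ} (hh : 0 < h) :
    1 / Real.sqrt h = h * (Real.sqrt h / h ^ 2) := by
  obtain ⟨s, hs, rfl⟩ : ∃ s : ℝ, 0 < s ∧ s ^ 2 = h :=
    ⟨Real.sqrt h, Real.sqrt_pos.mpr hh, Real.sq_sqrt hh.le⟩
  rw [Real.sqrt_sq hs.le]
  field_simp

/-- Power bookkeeping: `1/h = √h · (√h/h²)` for `h > 0`. -/
theorem one_div_eq {h : ℝ} (hh : 0 < h) :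
    1 / h = Real.sqrt h * (Real.sqrt h / h ^ 2) := by
  obtain ⟨s, hs, rfl⟩ : ∃ s : ℝ, 0 < s ∧ s ^ 2 = h :=
    ⟨Real.sqrt h, Real.sqrt_pos.mpr hh, Real.sq_sqrt hh.le⟩
  rw [Real.sqrt_sq hs.le]
  field_simp

/-- Power bookkeeping: `√(α/h)³ = α √α · (√h/h²)` for `α ≥ 0`, `h > 0`. -/
theorem sqrt_div_pow_three {α h : ℝ} (hα : 0 ≤ α) (hh : 0 < h) :
    Real.sqrt (α / h) ^ 3 = α * Real.sqrt α * (Real.sqrt h / h ^ 2) := by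
  obtain ⟨s, hs, rfl⟩ : ∃ s : ℝ, 0 < s ∧ s ^ 2 = h :=
    ⟨Real.sqrt h, Real.sqrt_pos.mpr hh, Real.sq_sqrt hh.le⟩
  obtain ⟨a, ha, rfl⟩ : ∃ a : ℝ, 0 ≤ a ∧ a ^ 2 = α :=
    ⟨Real.sqrt α, Real.sqrt_nonneg _, Real.sq_sqrt hα⟩
  rw [Real.sqrt_div (sq_nonneg a), Real.sqrt_sq hs.le, Real.sqrt_sq ha]
  field_simp

/-- IR bookkeeping: for `0 < h ≤ 4α`, `F ≤ Φ`, `0 ≤ Φ`, and `t ≥ 0` with `1/√h = h t`,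
`1/h = √h t`: `2 √(n/h) √F + F/h ≤ (8 √(nΦ) α + 2 Φ √α) t`. -/
theorem ir_arith {n F Φ h α t : ℝ} (hn : 0 ≤ n) (hF : F ≤ Φ) (hΦ : 0 ≤ Φ) (hh : 0 < h)
    (hα0 : 0 ≤ α) (hα : h ≤ 4 * α) (ht0 : 0 ≤ t) (ht1 : 1 / Real.sqrt h = h * t)
    (ht2 : 1 / h = Real.sqrt h * t) :
    2 * (Real.sqrt (n / h) * Real.sqrt F) + F / h ≤
      (8 * Real.sqrt (n * Φ) * α + 2 * Φ * Real.sqrt α) * t := by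
  have hsF : Real.sqrt F ≤ Real.sqrt Φ := Real.sqrt_le_sqrt hF
  have hs2 : Real.sqrt h ≤ 2 * Real.sqrt α :=
    (sq_le_sq₀ (Real.sqrt_nonneg _) (by positivity)).mp
      (by rw [Real.sq_sqrt hh.le, mul_pow, Real.sq_sqrt hα0]; linarith)
  have hA : Real.sqrt (n / h) * Real.sqrt F ≤ Real.sqrt (n * Φ) * (4 * α) * t := by
    rw [Real.sqrt_div hn, Real.sqrt_mul hn]
    calc Real.sqrt n / Real.sqrt h * Real.sqrt F
        = Real.sqrt n * Real.sqrt F * (1 / Real.sqrt h) := by ring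
      _ = Real.sqrt n * Real.sqrt F * (h * t) := by rw [ht1]
      _ ≤ Real.sqrt n * Real.sqrt Φ * (h * t) := by gcongr
      _ ≤ Real.sqrt n * Real.sqrt Φ * (4 * α * t) := by gcongr
      _ = Real.sqrt n * Real.sqrt Φ * (4 * α) * t := by ring
  have hB : F / h ≤ Φ * (2 * Real.sqrt α) * t := by
    calc F / h = F * (1 / h) := by ring
      _ = F * (Real.sqrt h * t) := by rw [ht2]
      _ ≤ Φ * (Real.sqrt h * t) := by gcongr
      _ ≤ Φ * (2 * Real.sqrt α * t) := by gcongr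
      _ = Φ * (2 * Real.sqrt α) * t := by ring
  linarith

/-- **Infrared blocks** (`h ≤ 4α`): `‖det (B + Δ)‖ ≤ ‖det B‖ · exp (q + (8 √(nΦ) α + 2 Φ √α) √h/h²)`
from the landed IR lemma `stub_detPerturbIR`, the bound `−q ≤ √(n/h) ‖Δ‖_F + ‖Δ‖_F²/(2h)`,
and the power bookkeeping of `ir_arith`. -/
theorem ir_case (B Δ : Matrix ι ι ℂ) {h Φ α : ℝ} (hh : 0 < h) (hΦ : 0 ≤ Φ) (hα0 : 0 ≤ α)
    (hα : h ≤ 4 * α) (hB : ∀ v : ι → ℂ, h * ∑ i, ‖v i‖ ^ 2 ≤ ∑ i, ‖(B.mulVec v) i‖ ^ 2)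
    (hF : ∑ i, ∑ j, ‖Δ i j‖ ^ 2 ≤ Φ) :
    ‖(B + Δ).det‖ ≤ ‖B.det‖ * Real.exp ((B⁻¹ * Δ).trace.re - (B⁻¹ * Δ * (B⁻¹ * Δ)).trace.re / 2
      + (8 * Real.sqrt (Fintype.card ι * Φ) * α + 2 * Φ * Real.sqrt α) * (Real.sqrt h / h ^ 2)) := by
  refine (stub_detPerturbIR B Δ h hh hB).trans
    (mul_le_mul_of_nonneg_left (Real.exp_le_exp.mpr ?_) (norm_nonneg _))
  have hq1 : -(B⁻¹ * Δ).trace.re ≤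
      Real.sqrt (Fintype.card ι / h) * Real.sqrt (∑ i, ∑ j, ‖Δ i j‖ ^ 2) := by
    have h1 := re_trace_inv_mul_le B (-Δ) hh hB
    simpa only [Matrix.mul_neg, Matrix.trace_neg, Complex.neg_re, Matrix.neg_apply,
      norm_neg] using h1
  have hq2 : (B⁻¹ * Δ * (B⁻¹ * Δ)).trace.re ≤ (∑ i, ∑ j, ‖Δ i j‖ ^ 2) / h :=
    (re_trace_mul_self_le _).trans (frob_inv_mul_le B Δ hh hB)
  have har := ir_arith (Nat.cast_nonneg (Fintype.card ι)) hF hΦ hh hα0 hα (by positivity)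
    (one_div_sqrt_eq hh) (one_div_eq hh)
  have e3 : (∑ i, ∑ j, ‖Δ i j‖ ^ 2) / (2 * h) = (∑ i, ∑ j, ‖Δ i j‖ ^ 2) / h / 2 := by ring
  linarith

/-- **Bulk blocks** (`4α ≤ h`): `‖det (B + Δ)‖ ≤ ‖det B‖ · exp (q + 2 n α √α · √h/h²)` from
`B + Δ = B (1 + B⁻¹Δ)`, the operator bound `Σᵢ ‖(B⁻¹Δ v)ᵢ‖² ≤ (α/h) Σᵢ ‖vᵢ‖²` and the landed
bulk lemma `stub_logDetSecondOrder` with `ρ = √(α/h) ≤ 1/2`, `ρ³ = α √α · √h/h²`. -/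
theorem bulk_case (B Δ : Matrix ι ι ℂ) {h α : ℝ} (hh : 0 < h) (hα0 : 0 ≤ α) (hα : 4 * α ≤ h)
    (hB : ∀ v : ι → ℂ, h * ∑ i, ‖v i‖ ^ 2 ≤ ∑ i, ‖(B.mulVec v) i‖ ^ 2)
    (hΔ : ∀ v : ι → ℂ, ∑ i, ‖(Δ.mulVec v) i‖ ^ 2 ≤ α * ∑ i, ‖v i‖ ^ 2) :
    ‖(B + Δ).det‖ ≤ ‖B.det‖ * Real.exp ((B⁻¹ * Δ).trace.re - (B⁻¹ * Δ * (B⁻¹ * Δ)).trace.re / 2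
      + 2 * Fintype.card ι * α * Real.sqrt α * (Real.sqrt h / h ^ 2)) := by
  have hU : IsUnit B.det := isUnit_iff_ne_zero.mpr (det_ne_zero_of_coercive B hh hB)
  have hρ0 : 0 ≤ Real.sqrt (α / h) := Real.sqrt_nonneg _
  have hρsq : Real.sqrt (α / h) ^ 2 = α / h := Real.sq_sqrt (div_nonneg hα0 hh.le)
  have hρhalf : Real.sqrt (α / h) ≤ 1 / 2 :=
    (sq_le_sq₀ hρ0 (by norm_num)).mp (by rw [hρsq, div_le_iff₀ hh]; linarith)
  have hR : ∀ v : ι → ℂ, ∑ i, ‖((B⁻¹ * Δ).mulVec v) i‖ ^ 2 ≤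
      Real.sqrt (α / h) ^ 2 * ∑ i, ‖v i‖ ^ 2 := fun v => by
    rw [hρsq, ← Matrix.mulVec_mulVec]
    calc ∑ i, ‖(B⁻¹ *ᵥ (Δ *ᵥ v)) i‖ ^ 2 ≤ (∑ i, ‖(Δ *ᵥ v) i‖ ^ 2) / h :=
          sum_norm_sq_inv_mulVec_le B hh hB _
      _ ≤ (α * ∑ i, ‖v i‖ ^ 2) / h := by gcongr; exact hΔ v
      _ = α / h * ∑ i, ‖v i‖ ^ 2 := by ring
  have hLD := stub_logDetSecondOrder (B⁻¹ * Δ) (Real.sqrt (α / h)) hρ0 hρhalf hR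
  have hfac : (B + Δ).det = B.det * (1 + B⁻¹ * Δ).det := by
    rw [← Matrix.det_mul, mul_add, mul_one, ← mul_assoc, Matrix.mul_nonsing_inv _ hU, one_mul]
  rw [hfac, norm_mul]
  refine mul_le_mul_of_nonneg_left (hLD.trans_eq ?_) (norm_nonneg _)
  rw [sqrt_div_pow_three hα0 hh]
  congr 1
  ring

end BlockEstimate

/-- **Uniform per-block estimate** (registered stub `stub_blockEstimate` of the line `Sketch`).
For a coercive block `B` (`h Σ‖vᵢ‖² ≤ Σ‖(Bv)ᵢ‖²`, `h > 0`) and a perturbation `Δ` with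
`‖Δ‖_F² ≤ Φ` and `‖Δ v‖² ≤ α ‖v‖²`, with `R = B⁻¹Δ` and `q = Re tr R − ½ Re tr R²`:
`‖det (B + Δ)‖ ≤ ‖det B‖ · exp (q + (8 √(nΦ) α + 2 Φ √α + 2 n α √α) · √h/h²)`.
Case split `h ≤ 4α` (`BlockEstimate.ir_case`, from `stub_detPerturbIR`) versus `4α ≤ h`
(`BlockEstimate.bulk_case`, from `stub_logDetSecondOrder`); the unused terms are nonnegative. -/
theorem stub_blockEstimate : ∀ {ι : Type} [Fintype ι] [DecidableEq ι] (B Δ : Matrix ι ι ℂ) (h Φ α : ℝ), 0 < h → 0 ≤ Φ → 0 ≤ α → (∀ v : ι → ℂ, h * ∑ i, ‖v i‖ ^ 2 ≤ ∑ i, ‖(B.mulVec v) i‖ ^ 2) → (∑ i, ∑ j, ‖Δ i j‖ ^ 2 ≤ Φ) → (∀ v : ι → ℂ, ∑ i, ‖(Δ.mulVec v) i‖ ^ 2 ≤ α * ∑ i, ‖v i‖ ^ 2) → ‖(B + Δ).det‖ ≤ ‖B.det‖ * Real.exp (((B⁻¹ * Δ).trace.re - ((B⁻¹ * Δ) * (B⁻¹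 * Δ)).trace.re / 2) + (8 * Real.sqrt (Fintype.card ι * Φ) * α + 2 * Φ * Real.sqrt α + 2 * Fintype.card ι * α * Real.sqrt α) * (Real.sqrt h / h ^ 2)) := by
  intro ι _ _ B Δ h Φ α hh hΦ hα hB hF hΔ
  rcases le_or_gt h (4 * α) with hIR | hbulk
  · refine (BlockEstimate.ir_case B Δ hh hΦ hα hIR hB hF).trans
      (mul_le_mul_of_nonneg_left (Real.exp_le_exp.mpr ?_) (norm_nonneg _))
    have hE3 : 0 ≤ 2 * (Fintype.card ι : ℝ) * α * Real.sqrt α * (Real.sqrt h / h ^ 2) := by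
      positivity
    linarith
  · refine (BlockEstimate.bulk_case B Δ hh hα hbulk.le hB hΔ).trans
      (mul_le_mul_of_nonneg_left (Real.exp_le_exp.mpr ?_) (norm_nonneg _))
    have hE1 : 0 ≤ 8 * Real.sqrt (Fintype.card ι * Φ) * α * (Real.sqrt h / h ^ 2) := by
      positivity
    have hE2 : 0 ≤ 2 * Φ * Real.sqrt α * (Real.sqrt h / h ^ 2) := by positivity
    linarith

end Summit.QuantumFields.QCD.Cruxes.CriticalLineDiamagnetism.ChessboardCellGain

end
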